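import Summits.AtomisticToContinuum.HydrodynamicLimit.Theorems.CollisionIsometryCLTMacroClosureDefs

/-!
# Stub `stub_thermo` of the line `IdeatorTwoGen1Sketch` (crux `MacroClosure`, stmt-14870) —
# part 2a: coercivity of the ideal-gas relative entropy

Support file (registered sub-goal `stub_thermo_idealCoercive`) for the stub
`Barycentric.stub_thermo : ∃ η₃, 0 < η₃ ∧ ThermoChamber η₃`. The relative entropy of the
monatomic ideal gas between the states `V = stateOf r v s` and `U = stateOf ρ u θ` is the sum of
three non-negative elementary terms,
`ρ ψ(r/ρ) + (3/2) r Φ(s/θ) + r |v − u|²/(2θ)`, `ψ(a) = a log a − a + 1` (`= klFun a`),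
`Φ(z) = z − 1 − log z`. We prove the two-regime lower bound
`m · min(‖V − U‖², ‖V − U‖) ≤ ρ ψ(r/ρ) + (3/2) r Φ(s/θ) + r |v − u|²/(2θ)` with `m > 0` depending
only on bounds `ρ ∈ [ρ₋, ρ₊]`, `θ ≤ θ₊`, `|u| ≤ M` (quadratic near `U` from `ψ(a) ≥ (a−1)²/4`,
`Φ(z) ≥ (z−1)²/8` on `(0, 2]`; linear far from `U` from `ψ(a) ≥ (log 2 − 1/2) a`, `a ≥ 2`).
Elementary real analysis; no equation of state enters.
-/

noncomputable section

open MeasureTheory Filter Set Topology InformationTheory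
open scoped ENNReal ContDiff

namespace Summit.AtomisticToContinuum.HydrodynamicLimit.Theorems.MacroClosureLine

open Literature.MathematicalPhysics.KineticTheory Literature.Analysis.FluidPDE
open Literature.Analysis.FunctionSpaces

namespace Barycentric

/-! ## Scalar inequalities for `ψ = klFun` and `Φ(z) = z − 1 − log z` -/

/-- The derivative of `a ↦ klFun a − (a − 1)²/4` is `log a − (a − 1)/2` (`a ≠ 0`). -/
theorem hasDerivAt_klFun_sub_sq {a : ℝ} (ha : a ≠ 0) :
    HasDerivAt (fun x => klFun x - (x - 1) ^ 2 / 4) (Real.log a - (a - 1) / 2) a := by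
  refine ((hasDerivAt_klFun ha).sub ((((hasDerivAt_id a).sub_const 1).pow 2).div_const
    4)).congr_deriv ?_
  simp only [id, Nat.cast_ofNat, Nat.add_one_sub_one, pow_one]
  ring

/-- **Quadratic lower bound for `klFun` near `1`**: `(a − 1)²/4 ≤ a log a − a + 1` on `(0, 2]`
(the gap `klFun a − (a−1)²/4` decreases on `(0, 1]` and increases on `[1, 2]`, vanishing at `1`). -/
theorem klFun_ge_sq {a : ℝ} (ha : 0 < a) (ha2 : a ≤ 2) : (a - 1) ^ 2 / 4 ≤ klFun a := by
  set g : ℝ → ℝ := fun x => klFun x - (x - 1) ^ 2 / 4 with hg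
  have hg1 : g 1 = 0 := by simp [g, klFun_one]
  suffices h : 0 ≤ g a by simpa [g] using h
  have hcont : Continuous g := continuous_klFun.sub (by fun_prop)
  rcases le_total a 1 with ha1 | ha1
  · have hanti : AntitoneOn g (Ioc 0 1) := by
      refine antitoneOn_of_deriv_nonpos (convex_Ioc 0 1) hcont.continuousOn ?_ ?_
      · rw [interior_Ioc]
        exact fun x hx => (hasDerivAt_klFun_sub_sq hx.1.ne').differentiableAt.differentiableWithinAt
      · rw [interior_Ioc]
        intro x hx
        rw [(hasDerivAt_klFun_sub_sq hx.1.ne').deriv]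
        linarith [hx.2, Real.log_le_sub_one_of_pos hx.1]
    simpa [hg1] using hanti ⟨ha, ha1⟩ ⟨zero_lt_one, le_rfl⟩ ha1
  · have hmono : MonotoneOn g (Icc 1 2) := by
      refine monotoneOn_of_deriv_nonneg (convex_Icc 1 2) hcont.continuousOn ?_ ?_
      · rw [interior_Icc]
        exact fun x hx => (hasDerivAt_klFun_sub_sq (by linarith [hx.1])).differentiableAt
          |>.differentiableWithinAt
      · rw [interior_Icc]
        intro x hx
        rw [(hasDerivAt_klFun_sub_sq (by linarith [hx.1])).deriv]
        have hx0 : 0 < x := by linarith [hx.1]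
        have h2 : (x - 1) / 2 ≤ 1 - x⁻¹ := by
          rw [div_le_iff₀ (by norm_num : (0 : ℝ) < 2)]
          rw [show (1 - x⁻¹) * 2 = (x - 1) * (2 / x) by field_simp]
          have hx2 : 1 ≤ 2 / x := by rw [le_div_iff₀ hx0]; linarith [hx.2]
          nlinarith [hx.1]
        linarith [Real.one_sub_inv_le_log_of_pos hx0]
    simpa [hg1] using hmono ⟨le_rfl, by norm_num⟩ ⟨ha1, ha2⟩ ha1

/-- **Linear lower bound for `klFun` far from `1`**: `(log 2 − 1/2) a ≤ a log a − a + 1` for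
`a ≥ 2` (from `log(a/2) ≥ 1 − 2/a`). -/
theorem klFun_ge_lin {a : ℝ} (ha2 : 2 ≤ a) : (Real.log 2 - 1 / 2) * a ≤ klFun a := by
  have ha : 0 < a := by linarith
  have h := Real.one_sub_inv_le_log_of_pos (by positivity : 0 < a / 2)
  rw [Real.log_div ha.ne' two_ne_zero] at h
  have h3 : a * (1 - (a / 2)⁻¹) ≤ a * (Real.log a - Real.log 2) := mul_le_mul_of_nonneg_left h ha.le
  rw [show a * (1 - (a / 2)⁻¹) = a - 2 by field_simp] at h3
  rw [klFun_apply]; nlinarith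

/-- `Φ(z) = z − 1 − log z ≥ 0` for `z > 0`. -/
theorem thermal_nonneg {z : ℝ} (hz : 0 < z) : 0 ≤ z - 1 - Real.log z :=
  by linarith [Real.log_le_sub_one_of_pos hz]

/-- The derivative of `z ↦ z − 1 − log z − (z − 1)²/8` is `1 − z⁻¹ − (z − 1)/4` (`z ≠ 0`). -/
theorem hasDerivAt_thermal_sub_sq {z : ℝ} (hz : z ≠ 0) :
    HasDerivAt (fun x => x - 1 - Real.log x - (x - 1) ^ 2 / 8) (1 - z⁻¹ - (z - 1) / 4) z := by
  refine ((((hasDerivAt_id z).sub_const 1).sub (Real.hasDerivAt_log hz)).sub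
    ((((hasDerivAt_id z).sub_const 1).pow 2).div_const 8)).congr_deriv ?_
  simp only [id, Nat.cast_ofNat, Nat.add_one_sub_one, pow_one]
  ring

/-- **Quadratic lower bound for `Φ` near `1`**: `(z − 1)²/8 ≤ z − 1 − log z` on `(0, 2]`. -/
theorem thermal_ge_sq {z : ℝ} (hz : 0 < z) (hz2 : z ≤ 2) :
    (z - 1) ^ 2 / 8 ≤ z - 1 - Real.log z := by
  set g : ℝ → ℝ := fun x => x - 1 - Real.log x - (x - 1) ^ 2 / 8 with hg
  have hg1 : g 1 = 0 := by simp [g]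
  have hcont : ContinuousOn g (Ioi 0) := by
    refine ContinuousOn.sub (ContinuousOn.sub (by fun_prop) ?_) (by fun_prop)
    exact Real.continuousOn_log.mono fun x hx => (ne_of_gt hx : x ≠ 0)
  suffices h : 0 ≤ g z by simpa [g] using h
  rcases le_total z 1 with hz1 | hz1
  · have hanti : AntitoneOn g (Ioc 0 1) := by
      refine antitoneOn_of_deriv_nonpos (convex_Ioc 0 1) (hcont.mono fun x hx => hx.1) ?_ ?_
      · rw [interior_Ioc]
        exact fun x hx => (hasDerivAt_thermal_sub_sq hx.1.ne').differentiableAt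
          |>.differentiableWithinAt
      · rw [interior_Ioc]
        intro x hx
        rw [(hasDerivAt_thermal_sub_sq hx.1.ne').deriv]
        have hx1 : 1 ≤ x⁻¹ := one_le_inv_iff₀.mpr ⟨hx.1, hx.2.le⟩
        have hmul := mul_le_mul_of_nonpos_left (show (1 : ℝ) / 4 ≤ x⁻¹ by linarith)
          (show x - 1 ≤ 0 by linarith [hx.2])
        rw [show 1 - x⁻¹ = (x - 1) * x⁻¹ by rw [sub_mul, mul_inv_cancel₀ hx.1.ne', one_mul]]
        linarith
    simpa [hg1] using hanti ⟨hz, hz1⟩ ⟨zero_lt_one, le_rfl⟩ hz1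
  · have hmono : MonotoneOn g (Icc 1 2) := by
      refine monotoneOn_of_deriv_nonneg (convex_Icc 1 2)
        (hcont.mono fun x hx => (lt_of_lt_of_le zero_lt_one hx.1 : 0 < x)) ?_ ?_
      · rw [interior_Icc]
        exact fun x hx => (hasDerivAt_thermal_sub_sq (by linarith [hx.1])).differentiableAt
          |>.differentiableWithinAt
      · rw [interior_Icc]
        intro x hx
        rw [(hasDerivAt_thermal_sub_sq (by linarith [hx.1])).deriv]
        have hxi : x⁻¹ ≤ 1 / 2 + (2 - x) / 2 := by
          rw [inv_eq_one_div, div_le_iff₀ (by linarith [hx.1] : (0 : ℝ) < x)]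
          nlinarith [hx.1, hx.2]
        nlinarith [hx.1, hx.2]
    simpa [hg1] using hmono ⟨le_rfl, by norm_num⟩ ⟨hz1, hz2⟩ hz1

/-- `log z ≤ log 2 + z/2 − 1` for `z > 0`. -/
theorem log_le_log_two_add {z : ℝ} (hz : 0 < z) : Real.log z ≤ Real.log 2 + z / 2 - 1 := by
  have h := Real.log_le_sub_one_of_pos (by positivity : 0 < z / 2)
  rw [Real.log_div hz.ne' two_ne_zero] at h
  linarith

/-- `min((z − 1)², |z − 1|) ≤ 8 Φ(z)` for `z > 0` (quadratic bound on `(0, 2]`; for `z ≥ 2` the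
linear bound `(z − 1)/4 ≤ Φ(z)` from `log z ≤ log 2 + z/2 − 1`, `log 2 < 0.7`). -/
theorem min_le_thermal {z : ℝ} (hz : 0 < z) :
    min ((z - 1) ^ 2) |z - 1| ≤ 8 * (z - 1 - Real.log z) := by
  rcases le_total z 2 with hz2 | hz2
  · exact (min_le_left _ _).trans (by linarith [thermal_ge_sq hz hz2])
  · rw [abs_of_nonneg (by linarith)]
    exact (min_le_right _ _).trans (by linarith [log_le_log_two_add hz, Real.log_two_lt_d9])

/-- `|z − 1| ≤ 1 + 2 Φ(z)` for `z > 0`. -/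
theorem abs_sub_one_le_thermal {z : ℝ} (hz : 0 < z) :
    |z - 1| ≤ 1 + 2 * (z - 1 - Real.log z) := by
  rcases le_total z 2 with hz2 | hz2
  · linarith [thermal_nonneg hz, show |z - 1| ≤ 1 by rw [abs_le]; constructor <;> linarith]
  · rw [abs_of_nonneg (by linarith)]
    linarith [log_le_log_two_add hz, Real.log_two_lt_d9]

/-- Sub-additivity of the two-regime modulus: `min((x+y)², x+y) ≤ 4 (min(x², x) + min(y², y))`
for `x, y ≥ 0`. -/
theorem min_sq_add_le {x y : ℝ} (hx : 0 ≤ x) (hy : 0 ≤ y) :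
    min ((x + y) ^ 2) (x + y) ≤ 4 * (min (x ^ 2) x + min (y ^ 2) y) := by
  have key : ∀ p q : ℝ, 0 ≤ q → q ≤ p → min ((p + q) ^ 2) (p + q) ≤ 4 * min (p ^ 2) p := by
    intro p q hq hqp
    rcases le_total p 1 with hp1 | hp1
    · exact (min_le_left _ _).trans (by rw [min_eq_left (by nlinarith : p ^ 2 ≤ p)]; nlinarith)
    · exact (min_le_right _ _).trans (by rw [min_eq_right (by nlinarith : p ≤ p ^ 2)]; linarith)
  rcases le_total y x with h | h
  · linarith [key x y hy h, le_min (sq_nonneg y) hy]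
  · have := key y x hx h
    rw [add_comm y x] at this
    linarith [le_min (sq_nonneg x) hx]

/-- Scaling of the two-regime modulus by `C ≥ 1`: `min((C D)², C D) ≤ C² min(D², D)`, `D ≥ 0`. -/
theorem min_sq_scale_le {C D : ℝ} (hC : 1 ≤ C) (hD : 0 ≤ D) :
    min ((C * D) ^ 2) (C * D) ≤ C ^ 2 * min (D ^ 2) D := by
  rcases le_total (D ^ 2) D with h | h
  · rw [min_eq_left h]
    exact (min_le_left _ _).trans (by rw [mul_pow])
  · rw [min_eq_right h]
    have h3 := mul_nonneg (mul_nonneg (sub_nonneg.2 hC) hD) (zero_le_one.trans hC)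
    exact (min_le_right _ _).trans (by nlinarith [h3])

/-! ## The core two-regime estimate -/

/-- **Core estimate.** For `a, z > 0`, `t ≥ 0` and `D = |a − 1| + a t + a t² + a |z − 1|`:
`min(D², D) ≤ 256 (klFun a + a Φ(z) + a t²)`. -/
theorem core_coercive {a z t : ℝ} (ha : 0 < a) (hz : 0 < z) (ht : 0 ≤ t) :
    min ((|a - 1| + a * t + a * t ^ 2 + a * |z - 1|) ^ 2)
        (|a - 1| + a * t + a * t ^ 2 + a * |z - 1|) ≤
      256 * (klFun a + a * (z - 1 - Real.log z) + a * t ^ 2) := by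
  have hΦ := thermal_nonneg hz
  have hk : 0 ≤ klFun a := klFun_nonneg ha.le
  have hd1 : 0 ≤ |a - 1| := abs_nonneg _
  have hd2 : 0 ≤ a * t := by positivity
  have hd3 : 0 ≤ a * t ^ 2 := by positivity
  have hd4 : 0 ≤ a * |z - 1| := by positivity
  rcases le_or_gt a 2 with ha2 | ha2
  · -- quadratic regime
    have h1 : min (|a - 1| ^ 2) |a - 1| ≤ 4 * klFun a :=
      (min_le_left _ _).trans (by rw [sq_abs]; linarith [klFun_ge_sq ha ha2])
    have h2 : min ((a * t) ^ 2) (a * t) ≤ 2 * (a * t ^ 2) :=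
      (min_le_left _ _).trans (by nlinarith [sq_nonneg t])
    have h3 : min ((a * t ^ 2) ^ 2) (a * t ^ 2) ≤ a * t ^ 2 := min_le_right _ _
    have h4 : min ((a * |z - 1|) ^ 2) (a * |z - 1|) ≤ 16 * (a * (z - 1 - Real.log z)) := by
      have hm := min_le_thermal hz
      rcases le_total ((z - 1) ^ 2) |z - 1| with hc | hc
      · rw [min_eq_left hc] at hm
        refine (min_le_left _ _).trans ?_
        rw [mul_pow, sq_abs]
        nlinarith [mul_le_mul_of_nonneg_left hm ha.le,
          mul_le_mul_of_nonneg_right ha2 (mul_nonneg ha.le (sq_nonneg (z - 1)))]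
      · rw [min_eq_right hc] at hm
        exact (min_le_right _ _).trans (by nlinarith [mul_le_mul_of_nonneg_left hm ha.le])
    have s1 := min_sq_add_le hd1 hd2
    have s2 := min_sq_add_le (add_nonneg hd1 hd2) hd3
    have s3 := min_sq_add_le (add_nonneg (add_nonneg hd1 hd2) hd3) hd4
    nlinarith [s1, s2, s3, h1, h2, h3, h4,
      le_min (sq_nonneg (|a - 1| + a * t)) (add_nonneg hd1 hd2),
      le_min (sq_nonneg (|a - 1| + a * t + a * t ^ 2)) (add_nonneg (add_nonneg hd1 hd2) hd3)]
  · -- linear regime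
    refine (min_le_right _ _).trans ?_
    have hab : |a - 1| ≤ a := by rw [abs_of_nonneg (by linarith)]; linarith
    have ht1 : t ≤ (1 + t ^ 2) / 2 := by nlinarith [sq_nonneg (t - 1)]
    have hkl := klFun_ge_lin ha2.le
    have hsum : |a - 1| + a * t + a * t ^ 2 + a * |z - 1| ≤
        a * (5 / 2 + 3 / 2 * t ^ 2 + 2 * (z - 1 - Real.log z)) := by
      have e1 : a * t ≤ a * ((1 + t ^ 2) / 2) := mul_le_mul_of_nonneg_left ht1 ha.le
      have e2 : a * |z - 1| ≤ a * (1 + 2 * (z - 1 - Real.log z)) :=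
        mul_le_mul_of_nonneg_left (abs_sub_one_le_thermal hz) ha.le
      nlinarith
    have hc0 : a * (5 / 2) ≤ 14 * klFun a := by nlinarith [Real.log_two_gt_d9]
    nlinarith [hsum, hc0, mul_nonneg ha.le hΦ, mul_nonneg ha.le (sq_nonneg t)]

/-! ## The ideal relative entropy in conserved variables -/

/-- The sup norm of a state is at most the sum of the norms of its three components. -/
theorem norm_state_le (W : State) : ‖W‖ ≤ |W.1| + ‖W.2.1‖ + |W.2.2| := by
  rw [Prod.norm_def, Prod.norm_def, Real.norm_eq_abs, Real.norm_eq_abs]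
  have := abs_nonneg W.1; have := norm_nonneg W.2.1; have := abs_nonneg W.2.2
  exact max_le (by linarith) (max_le (by linarith) (by linarith))

/-- The difference of two `stateOf` states is controlled by the primitive increments: with
`a = r/ρ`, `z = s/θ`, `t = |v − u|`, `|u| ≤ M`, `θ ≤ θ₊`,
`‖stateOf r v s − stateOf ρ u θ‖ ≤ ρ (2 + M + M²/2 + (3/2)θ₊) (|a−1| + a t + a t² + a |z−1|)`. -/
theorem norm_stateOf_sub_le {ρ θ θM M r s : ℝ} {u v : V3} (hρ : 0 < ρ) (hθ : 0 < θ)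
    (hθM : θ ≤ θM) (hM : ‖u‖ ≤ M) (hr : 0 < r) :
    ‖stateOf r v s - stateOf ρ u θ‖ ≤ ρ * (2 + M + M ^ 2 / 2 + 3 / 2 * θM) *
      (|r / ρ - 1| + r / ρ * ‖v - u‖ + r / ρ * ‖v - u‖ ^ 2 + r / ρ * |s / θ - 1|) := by
  set a := r / ρ with ha_def
  set z := s / θ with hz_def
  set t := ‖v - u‖ with ht_def
  have ha : 0 < a := div_pos hr hρ
  have hM0 : 0 ≤ M := (norm_nonneg u).trans hM
  have ht0 : 0 ≤ t := norm_nonneg _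
  have hra : r = ρ * a := by rw [ha_def]; field_simp
  have hsz : s = θ * z := by rw [hz_def]; field_simp
  have hθM0 : 0 ≤ θM := hθ.le.trans hθM
  -- density
  have hρ' : |(stateOf r v s - stateOf ρ u θ).1| = ρ * |a - 1| := by
    simp only [Prod.fst_sub, stateOf]
    rw [hra, show ρ * a - ρ = ρ * (a - 1) by ring, abs_mul, abs_of_pos hρ]
  -- momentum
  have hm' : ‖(stateOf r v s - stateOf ρ u θ).2.1‖ ≤ ρ * (a * t) + ρ * |a - 1| * M := by
    simp only [Prod.snd_sub, Prod.fst_sub, stateOf]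
    have hsplit : r • v - ρ • u = r • (v - u) + (r - ρ) • u := by
      rw [smul_sub, sub_smul]; abel
    rw [hsplit]
    refine (norm_add_le _ _).trans ?_
    rw [norm_smul, norm_smul, Real.norm_eq_abs, Real.norm_eq_abs, abs_of_pos hr, hra,
      show ρ * a - ρ = ρ * (a - 1) by ring, abs_mul, abs_of_pos hρ]
    nlinarith [mul_le_mul_of_nonneg_left hM (by positivity : 0 ≤ ρ * |a - 1|)]
  -- energy
  have hE' : |(stateOf r v s - stateOf ρ u θ).2.2| ≤
      ρ * |a - 1| * (M ^ 2 / 2 + 3 / 2 * θM) + ρ * a * (M * t + t ^ 2 / 2) +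
        3 / 2 * ρ * a * θM * |z - 1| := by
    simp only [Prod.snd_sub, stateOf, totalEnergyDensity]
    have hv : ‖v‖ ^ 2 = ‖u‖ ^ 2 + 2 * inner ℝ u (v - u) + t ^ 2 := by
      rw [ht_def, ← norm_add_sq_real, add_sub_cancel]
    have hI : |inner ℝ u (v - u)| ≤ M * t :=
      (abs_real_inner_le_norm _ _).trans (mul_le_mul_of_nonneg_right hM ht0)
    rw [hv, hra, hsz]
    have hsplit : ρ * a * ((‖u‖ ^ 2 + 2 * inner ℝ u (v - u) + t ^ 2) / 2 + 3 / 2 * (θ * z)) -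
        ρ * (‖u‖ ^ 2 / 2 + 3 / 2 * θ) =
        ρ * (a - 1) * (‖u‖ ^ 2 / 2 + 3 / 2 * θ) + ρ * a * (inner ℝ u (v - u) + t ^ 2 / 2) +
          3 / 2 * ρ * a * θ * (z - 1) := by ring
    rw [hsplit]
    refine (abs_add_three _ _ _).trans ?_
    have e1 : |ρ * (a - 1) * (‖u‖ ^ 2 / 2 + 3 / 2 * θ)| ≤
        ρ * |a - 1| * (M ^ 2 / 2 + 3 / 2 * θM) := by
      rw [abs_mul, abs_mul, abs_of_pos hρ,
        abs_of_nonneg (by positivity : (0 : ℝ) ≤ ‖u‖ ^ 2 / 2 + 3 / 2 * θ)]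
      refine mul_le_mul_of_nonneg_left ?_ (by positivity)
      nlinarith [pow_le_pow_left₀ (norm_nonneg u) hM 2]
    have e2 : |ρ * a * (inner ℝ u (v - u) + t ^ 2 / 2)| ≤ ρ * a * (M * t + t ^ 2 / 2) := by
      rw [abs_mul, abs_of_pos (mul_pos hρ ha)]
      refine mul_le_mul_of_nonneg_left ((abs_add_le _ _).trans ?_) (by positivity)
      rw [abs_of_nonneg (by positivity : (0 : ℝ) ≤ t ^ 2 / 2)]
      linarith
    have e3 : |3 / 2 * ρ * a * θ * (z - 1)| ≤ 3 / 2 * ρ * a * θM * |z - 1| := by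
      rw [abs_mul, abs_of_pos (by positivity : (0 : ℝ) < 3 / 2 * ρ * a * θ)]
      exact mul_le_mul_of_nonneg_right (by nlinarith [ha.le, hρ.le]) (abs_nonneg _)
    linarith
  refine (norm_state_le _).trans ?_
  rw [hρ']
  have hC1 : ρ * |a - 1| + (ρ * (a * t) + ρ * |a - 1| * M) +
      (ρ * |a - 1| * (M ^ 2 / 2 + 3 / 2 * θM) + ρ * a * (M * t + t ^ 2 / 2) +
        3 / 2 * ρ * a * θM * |z - 1|) ≤
      ρ * (2 + M + M ^ 2 / 2 + 3 / 2 * θM) * (|a - 1| + a * t + a * t ^ 2 + a * |z - 1|) := by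
    have p1 : 0 ≤ ρ * |a - 1| := by positivity
    have p2 : 0 ≤ ρ * (a * t) := by positivity
    have p3 : 0 ≤ ρ * (a * t ^ 2) := by positivity
    have p4 : 0 ≤ ρ * (a * |z - 1|) := by positivity
    nlinarith [mul_nonneg p1 hM0, mul_nonneg p2 hM0, mul_nonneg p2 hθM0, mul_nonneg p3 hM0,
      mul_nonneg p3 hθM0, mul_nonneg p4 hM0, mul_nonneg (mul_nonneg p1 hM0) hM0,
      mul_nonneg (mul_nonneg p2 hM0) hM0, mul_nonneg (mul_nonneg p3 hM0) hM0,
      mul_nonneg (mul_nonneg p4 hM0) hM0, mul_nonneg p4 hθM0, mul_nonneg p1 hθM0]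
  linarith [hm', hE', hC1]

/-- The three ideal terms in the primitive ratios `a = r/ρ`, `z = s/θ`. -/
theorem ideal_terms_eq {ρ θ r s : ℝ} (u v : V3) (hρ : 0 < ρ) (hθ : 0 < θ) (hr : 0 < r)
    (hs : 0 < s) :
    (r * Real.log r - r * Real.log ρ - r + ρ) +
        3 / 2 * r * (s / θ - 1 - (Real.log s - Real.log θ)) + r * ‖v - u‖ ^ 2 / (2 * θ) =
      ρ * klFun (r / ρ) + 3 / 2 * ρ * (r / ρ) * (s / θ - 1 - Real.log (s / θ)) +
        ρ / (2 * θ) * ((r / ρ) * ‖v - u‖ ^ 2) := by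
  rw [klFun_apply, Real.log_div hr.ne' hρ.ne', Real.log_div hs.ne' hθ.ne']
  field_simp
  ring

/-- **Registered sub-goal `stub_thermo_idealCoercive` of `stub_thermo`: coercivity of the ideal
relative entropy.** For `ρ ∈ [ρ₋, ρ₊]`, `0 < θ ≤ θ₊`, `|u| ≤ M` and every `r, s > 0`, `v`,
`m · min(‖V − U‖², ‖V − U‖) ≤ [r log(r/ρ) − r + ρ] + (3/2) r Φ(s/θ) + r|v − u|²/(2θ)` with the
explicit constant `m = ρ₋ min(1, 1/(2θ₊)) / (256 max(1, ρ₊(2 + M + M²/2 + (3/2)θ₊))²)`. -/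
theorem stub_thermo_idealCoercive : ∀ (ρm ρM θM M : ℝ), 0 < ρm → 0 < θM → 0 ≤ M →
    ∀ (ρ θ : ℝ) (u : V3), ρm ≤ ρ → ρ ≤ ρM → 0 < θ → θ ≤ θM → ‖u‖ ≤ M →
    ∀ (r s : ℝ) (v : V3), 0 < r → 0 < s →
    ρm * min 1 (1 / (2 * θM)) / (256 * (max 1 (ρM * (2 + M + M ^ 2 / 2 + 3 / 2 * θM))) ^ 2) *
        min (‖stateOf r v s - stateOf ρ u θ‖ ^ 2) ‖stateOf r v s - stateOf ρ u θ‖ ≤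
      (r * Real.log r - r * Real.log ρ - r + ρ) +
        3 / 2 * r * (s / θ - 1 - (Real.log s - Real.log θ)) + r * ‖v - u‖ ^ 2 / (2 * θ) := by
  intro ρm ρM θM M hρm hθM hM ρ θ u hρ1 hρ2 hθ hθ2 hu r s v hr hs
  have hρ : 0 < ρ := hρm.trans_le hρ1
  set a := r / ρ with ha_def
  set z := s / θ with hz_def
  set t := ‖v - u‖ with ht_def
  have ha : 0 < a := div_pos hr hρ
  have hz : 0 < z := div_pos hs hθ
  set C := 2 + M + M ^ 2 / 2 + 3 / 2 * θM with hC_def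
  set C' := max 1 (ρM * C) with hC'_def
  set c := ρm * min 1 (1 / (2 * θM)) with hc_def
  set D := |a - 1| + a * t + a * t ^ 2 + a * |z - 1| with hD_def
  set S := klFun a + a * (z - 1 - Real.log z) + a * t ^ 2 with hS_def
  have hD0 : 0 ≤ D := by positivity
  have hC'1 : 1 ≤ C' := le_max_left _ _
  -- (i) the ideal terms dominate `c S`
  rw [ideal_terms_eq u v hρ hθ hr hs]
  have hΦ := thermal_nonneg hz
  have hk : 0 ≤ klFun a := klFun_nonneg ha.le
  have hcρ : c ≤ ρ := by nlinarith [min_le_left (1 : ℝ) (1 / (2 * θM))]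
  have hcθ : c ≤ ρ / (2 * θ) := by
    have h1 : min 1 (1 / (2 * θM)) ≤ 1 / (2 * θM) := min_le_right _ _
    have h2 : ρm * (1 / (2 * θM)) ≤ ρ / (2 * θ) := by
      rw [mul_one_div, div_le_div_iff₀ (by positivity) (by positivity)]
      nlinarith
    nlinarith
  have hlow : c * S ≤
      ρ * klFun a + 3 / 2 * ρ * a * (z - 1 - Real.log z) + ρ / (2 * θ) * (a * t ^ 2) := by
    have e1 : c * klFun a ≤ ρ * klFun a := mul_le_mul_of_nonneg_right hcρ hk
    have e2 : c * (a * (z - 1 - Real.log z)) ≤ 3 / 2 * ρ * a * (z - 1 - Real.log z) := by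
      nlinarith [mul_nonneg ha.le hΦ]
    have e3 : c * (a * t ^ 2) ≤ ρ / (2 * θ) * (a * t ^ 2) :=
      mul_le_mul_of_nonneg_right hcθ (by positivity)
    linarith [show c * S = c * klFun a + c * (a * (z - 1 - Real.log z)) + c * (a * t ^ 2) by
      rw [hS_def]; ring]
  -- (ii) the norm is at most `C' D`
  have hnorm : ‖stateOf r v s - stateOf ρ u θ‖ ≤ C' * D := by
    have h := norm_stateOf_sub_le (θM := θM) (M := M) (s := s) (v := v) hρ hθ hθ2 hu hr
    have hCpos : 0 < C := by rw [hC_def]; positivity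
    refine h.trans (mul_le_mul_of_nonneg_right ?_ hD0)
    exact (mul_le_mul_of_nonneg_right hρ2 hCpos.le).trans (le_max_right _ _)
  -- (iii) combine with the core estimate
  have hmin : min (‖stateOf r v s - stateOf ρ u θ‖ ^ 2) ‖stateOf r v s - stateOf ρ u θ‖ ≤
      C' ^ 2 * (256 * S) :=
    ((min_le_min (pow_le_pow_left₀ (norm_nonneg _) hnorm 2) hnorm).trans
      (min_sq_scale_le hC'1 hD0)).trans
      (mul_le_mul_of_nonneg_left (core_coercive ha hz (norm_nonneg _)) (by positivity))
  refine le_trans ?_ hlow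
  refine (mul_le_mul_of_nonneg_left hmin (by positivity : 0 ≤ c / (256 * C' ^ 2))).trans
    (le_of_eq ?_)
  field_simp

end Barycentric

end Summit.AtomisticToContinuum.HydrodynamicLimit.Theorems.MacroClosureLine

end
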